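import Summits.ResolutionOfSingularities.ResolutionOfSingularities.Theorems.FrobeniusClosingSteerQuadraticStepLemmas
import Literature.AlgebraicGeometry.Resolution.QuadraticTransforms
import Literature.AlgebraicGeometry.Resolution.QuadraticTransformDelta
import Mathlib.Algebra.CharP.Two
import Mathlib.RingTheory.Localization.AtPrime.Basic
import HarnessLib

/-!
# Bad curves under the two moves of the LOW tower (D3c of the σ-residual LOW half, W4.1 — step lemmas)

W4.1, crux `Steer` (stmt-ResolutionOfSingularities-16345), σ-line at `p = 2`, LOW half: res-L0-w41-idea-3 card 3 v3 piece
**D3c = F5 TAMING** (res-L0-w41-plan-1 RULING 18d / 21b(iv); res-L0-w41-strat-2 §σ2.23 `LowLipman-s23-strat2.r27.delta.lean`: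
«point steps eventually at NORMAL members (F5 = D3c)»; the concrete tower is res-D-pv-012's D3a: `A n = φ(R n) ⊆ κ` subrings of ONE
residue field, a POINT step is a quadratic transform `IsQuadraticTransform (A n) (A (n+1))` inside `κ` with radicand law
`h' · x̄² = h − ḡ²`, a CURVE step keeps `A` and has `h = w̄² h' + ḡ²`). Theses-free, def-free step lemmas, encoding-independent:

* §1 `sub_sq_mem_of_curveStep` — F5 (i): in characteristic `2`, `h = w² h' + g²` and `h' ≡ γ² (mod I)` give
  `h ≡ (w γ + g)² (mod I)`: along a curve step the singular primes of the new radicand are singular primes of the old one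
  (res-type-082's criterion `RadicandSingular.not_isRegularLocalRing_adjoinRoot_atPrime_iff` reads singularity at `𝔮` as
  «`h − γ² ∈ (𝔮 A_𝔮)²` for some `γ`»);
* §1 `exists_sub_sq_mem_iff_of_pointStep` — F5 (ii), radicand part: `h' x² = h − g²` with `x` a UNIT gives
  «`∃ γ', h' − γ'² ∈ I` ↔ `∃ γ, h − γ² ∈ I`» — off the exceptional prime the point step does not change singularity;
* §2 `not_mem_of_comap_ne_maximalIdeal` — for a quadratic transform `A ⊂ A'` in the chart of `x`, a prime `𝔮'` of `A'` with
  `𝔮' ∩ A ≠ 𝔪_A` does not contain `x` (it is NOT the exceptional prime);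
* §2 `exists_mul_eq_mul_of_quadraticTransform` — **off the exceptional prime a quadratic transform is a local isomorphism**,
  membership form: every `z ∈ A'` and `s ∈ A' ∖ 𝔮'` admit `a ∈ A`, `b ∈ A ∖ 𝔮'` with `z · b = a · s`;
* §3 `isLocalization_atPrime_of_quadraticTransform` — hence `(A')_{𝔮'}` IS the localisation of `A` at `𝔮' ∩ A`
  (`IsLocalization.AtPrime` over the composite `A → A' → (A')_{𝔮'}`), so the two local rings — and the singularity of the
  radicand along `𝔮'` and along `𝔮' ∩ A` — agree, and the curve germ `A'/𝔮'` sits over the curve germ `A/(𝔮' ∩ A)` inside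
  the common residue field (F5 (ii): bad curves are never created and have lineages; the lineage engine is
  `CurveLineage.eventually_isDiscreteValuationRing_of_lineage`, p515973).

No Theses file of W4.1 is imported; nothing here is a route item. OURS (the W4.1 engine), standard commutative algebra;
NOT a statement of the manuscript under review [claim: Hironaka2017, status: under-review]. [cite: Cutkosky2014, §2.1]
[cite: Kollar2007, §1.4] [cite: Matsumura1987, Thm. 14.2]
-/

noncomputable section

-- `Summit.<S>.<S>.…` duplicates the summit name by design (single-problem summit).
set_option linter.dupNamespace false

open IsLocalRing Literature.AlgebraicGeometry.Resolution

namespace Summit.ResolutionOfSingularities.ResolutionOfSingularities.Theorems.SwitchingDichotomy.BadCurveStep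

/-! ## §1 Radicand algebra of the two moves (characteristic 2) -/

section Radicand

variable {V : Type*} [CommRing V] [CharP V 2]

/-- **F5 (i), curve step**: `h = w² h' + g²` and `h' − γ² ∈ I` give `h − (w γ + g)² = w² (h' − γ²) ∈ I`
(characteristic `2`). [folklore] -/
theorem sub_sq_mem_of_curveStep (I : Ideal V) {h h' w g γ : V} (hlaw : h = w ^ 2 * h' + g ^ 2)
    (hγ : h' - γ ^ 2 ∈ I) : h - (w * γ + g) ^ 2 ∈ I := by
  have key : h - (w * γ + g) ^ 2 = w ^ 2 * (h' - γ ^ 2) := by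
    rw [CharTwo.add_sq, mul_pow, hlaw]; ring
  rw [key]
  exact Ideal.mul_mem_left _ _ hγ

/-- **F5 (i), curve step, existential form**: a cleaning of `h'` into `I` yields a cleaning of `h` into `I`. [folklore] -/
theorem exists_sub_sq_mem_of_curveStep (I : Ideal V) {h h' w g : V} (hlaw : h = w ^ 2 * h' + g ^ 2)
    (hγ : ∃ γ : V, h' - γ ^ 2 ∈ I) : ∃ γ : V, h - γ ^ 2 ∈ I := by
  obtain ⟨γ, hγ⟩ := hγ
  exact ⟨w * γ + g, sub_sq_mem_of_curveStep I hlaw hγ⟩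

/-- **F5 (ii), point step, radicand part**: `h' x² = h − g²` with `x` a unit gives
`(∃ γ', h' − γ'² ∈ I) ↔ (∃ γ, h − γ² ∈ I)` (`γ = g + x γ'`, `γ' = (γ − g) x⁻¹`; characteristic `2`). [folklore] -/
theorem exists_sub_sq_mem_iff_of_pointStep (I : Ideal V) {h h' x g : V} (hx : IsUnit x)
    (hlaw : h' * x ^ 2 = h - g ^ 2) : (∃ γ' : V, h' - γ' ^ 2 ∈ I) ↔ (∃ γ : V, h - γ ^ 2 ∈ I) := by
  obtain ⟨u, rfl⟩ := hx
  constructor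
  · rintro ⟨γ', hγ'⟩
    refine ⟨g + (u : V) * γ', ?_⟩
    have key : h - (g + (u : V) * γ') ^ 2 = (u : V) ^ 2 * (h' - γ' ^ 2) := by
      rw [CharTwo.add_sq, mul_pow]
      linear_combination (-1 : V) * hlaw
    rw [key]
    exact Ideal.mul_mem_left _ _ hγ'
  · rintro ⟨γ, hγ⟩
    refine ⟨(γ - g) * (↑u⁻¹ : V), ?_⟩
    have hsq : (γ - g) ^ 2 = γ ^ 2 - g ^ 2 := by
      haveI : Fact (Nat.Prime 2) := ⟨Nat.prime_two⟩
      exact sub_pow_char (R := V) γ g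
    have key : h' - ((γ - g) * (↑u⁻¹ : V)) ^ 2 = (↑u⁻¹ : V) ^ 2 * (h - γ ^ 2) := by
      have hu : (u : V) * (↑u⁻¹ : V) = 1 := Units.mul_inv u
      rw [mul_pow, hsq]
      have h1 : h' = (h - g ^ 2) * (↑u⁻¹ : V) ^ 2 := by
        rw [← hlaw]
        calc h' = h' * ((u : V) * (↑u⁻¹ : V)) ^ 2 := by rw [hu, one_pow, mul_one]
          _ = h' * (u : V) ^ 2 * (↑u⁻¹ : V) ^ 2 := by rw [mul_pow, mul_assoc]
      rw [h1]; ring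
    rw [key]
    exact Ideal.mul_mem_left _ _ hγ

end Radicand

/-! ## §2 Off the exceptional prime a quadratic transform is a local isomorphism (membership form) -/

variable {K : Type} [Field K]

/-- In a quadratic transform `A ⊂ A'` written in the chart of `x ∈ 𝔪_A ∖ 0` (`A[𝔪_A/x] ⊆ A'`), a prime `𝔮'` of `A'` whose
contraction to `A` is not `𝔪_A` does NOT contain `x`: otherwise every `y = (y/x) · x ∈ 𝔪_A` would lie in `𝔮'`
(only `x ≠ 0` and `A[𝔪_A/x] ⊆ A'` are used). [folklore] -/
theorem not_mem_of_comap_ne_maximalIdeal {A A' : Subring K} [IsLocalRing A] (hle : A ≤ A') {x : A}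
    (hx0 : (x : K) ≠ 0) (hB : blowupRing A (x : K) ≤ A') (𝔮' : Ideal A') [𝔮'.IsPrime]
    (hne : 𝔮'.comap (Subring.inclusion hle) ≠ maximalIdeal A) : Subring.inclusion hle x ∉ 𝔮' := by
  intro hxq
  apply hne
  refine ((IsLocalRing.maximalIdeal.isMaximal A).eq_of_le (Ideal.IsPrime.ne_top inferInstance) fun y hy => ?_).symm
  rw [Ideal.mem_comap]
  have hyx : (y : K) / x ∈ A' := hB (div_mem_blowupRing (x : K) hy)
  have hEq : Subring.inclusion hle y = ⟨(y : K) / x, hyx⟩ * Subring.inclusion hle x := by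
    apply Subtype.ext
    change (y : K) = (y : K) / x * x
    rw [div_mul_cancel₀ _ hx0]
  rw [hEq]
  exact Ideal.mul_mem_left _ _ hxq

/-- A denominator of the quadratic-transform presentation (`b ∈ A'`, `b⁻¹ ∈ A'`, `b ≠ 0`) is a unit of `A'`, hence outside
every prime. [folklore] -/
theorem not_mem_prime_of_inv_mem {A' : Subring K} {b : K} (hb : b ∈ A') (hbinv : b⁻¹ ∈ A') (hb0 : b ≠ 0)
    (𝔮' : Ideal A') [𝔮'.IsPrime] : (⟨b, hb⟩ : A') ∉ 𝔮' := by
  intro hmem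
  have hu : IsUnit (⟨b, hb⟩ : A') := (isUnit_subring_iff_inv_mem _).mpr ⟨hb0, hbinv⟩
  exact (Ideal.IsPrime.ne_top inferInstance) (Ideal.eq_top_of_isUnit_mem _ hmem hu)

/-- **Off the exceptional prime a quadratic transform is a local isomorphism** (membership form). Let `A ⊂ A'` be a
quadratic transform of local subrings of the field `κ` (`A' = A[𝔪_A/x]_𝔫`, Cutkosky §2.1 / the tree's `IsQuadraticTransform`) and `𝔮'`
a prime of `A'` with `𝔮' ∩ A ≠ 𝔪_A`. Then every `z ∈ A'` and `s ∈ A' ∖ 𝔮'` admit `a ∈ A` and `b ∈ A` with `b ∉ 𝔮'` (as an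
element of `A'`) and `z · b = a · s`: writing `z = α/β`, `s = σ/τ` with `α, β, σ, τ ∈ A[𝔪_A/x]`, `β, τ` units of `A'`, and
`α = α₀/xⁱ`, `β = β₀/xʲ`, `σ = σ₀/xᵏ`, `τ = τ₀/xˡ` with `α₀, … ∈ A`, take `a = α₀ τ₀ x^{j+k}`, `b = β₀ σ₀ x^{i+l}` — none of
`β₀, σ₀, x` lies in `𝔮'`. [cite: Cutkosky2014, §2.1] -/
theorem exists_mul_eq_mul_of_quadraticTransform {A A' : Subring K} [IsLocalRing A] (h : IsQuadraticTransform A A')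
    (𝔮' : Ideal A') [𝔮'.IsPrime] (hne : 𝔮'.comap (Subring.inclusion h.dominates.1) ≠ maximalIdeal A)
    {z s : K} (hz : z ∈ A') (hs : s ∈ A') (hsq : (⟨s, hs⟩ : A') ∉ 𝔮') :
    ∃ (a b : K) (_ : a ∈ A) (hb : b ∈ A), (⟨b, h.dominates.1 hb⟩ : A') ∉ 𝔮' ∧ z * b = a * s := by
  have hle : A ≤ A' := h.dominates.1
  obtain ⟨_, x, hxm, hx0, hloc, hB, hfrac, hdom⟩ := h
  have hx0' : (x : K) ≠ 0 := fun e => hx0 (Subtype.ext e)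
  have hxq : Subring.inclusion hle x ∉ 𝔮' := not_mem_of_comap_ne_maximalIdeal hle hx0' hB 𝔮' hne
  -- membership in `𝔮'` as a predicate on elements of `κ` known to lie in `A'`
  have hmul : ∀ {u v : K} (hu : u ∈ A') (hv : v ∈ A'), (⟨u, hu⟩ : A') ∉ 𝔮' → (⟨v, hv⟩ : A') ∉ 𝔮' →
      (⟨u * v, A'.mul_mem hu hv⟩ : A') ∉ 𝔮' := by
    intro u v hu hv hu' hv' hmem
    have hmem' : (⟨u, hu⟩ : A') * ⟨v, hv⟩ ∈ 𝔮' := by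
      have : (⟨u, hu⟩ : A') * ⟨v, hv⟩ = ⟨u * v, A'.mul_mem hu hv⟩ := Subtype.ext rfl
      rw [this]; exact hmem
    rcases Ideal.IsPrime.mem_or_mem inferInstance hmem' with h1 | h1
    · exact hu' h1
    · exact hv' h1
  have hxpow : ∀ n : ℕ, (⟨(x : K) ^ n, A'.pow_mem (hle x.2) n⟩ : A') ∉ 𝔮' := by
    intro n hmem
    have heq : (Subring.inclusion hle x) ^ n = ⟨(x : K) ^ n, A'.pow_mem (hle x.2) n⟩ := Subtype.ext rfl
    exact hxq (Ideal.IsPrime.mem_of_pow_mem inferInstance n (heq ▸ hmem))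
  -- a factor of an element off `𝔮'` is off `𝔮'`: if `u * v ∉ 𝔮'`-type bookkeeping via `c = d * e ⇒ d ∉ 𝔮'`
  have hfactor : ∀ {c d e : K} (hc : c ∈ A') (hd : d ∈ A') (he : e ∈ A'), c = d * e → (⟨c, hc⟩ : A') ∉ 𝔮' →
      (⟨d, hd⟩ : A') ∉ 𝔮' := by
    intro c d e hc hd he hcde hc' hdmem
    apply hc'
    have : (⟨c, hc⟩ : A') = ⟨d, hd⟩ * ⟨e, he⟩ := Subtype.ext hcde
    rw [this]
    exact Ideal.mul_mem_right _ _ hdmem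
  by_cases hz0 : z = 0
  · refine ⟨0, 1, A.zero_mem, A.one_mem, ?_, by rw [hz0, zero_mul, zero_mul]⟩
    have h1 : (⟨(1 : K), hle A.one_mem⟩ : A') = 1 := Subtype.ext rfl
    rw [h1]
    exact (Ideal.ne_top_iff_one _).mp (Ideal.IsPrime.ne_top inferInstance)
  -- `z = α/β`, `s = σ/τ`
  obtain ⟨α, hα, β, hβ, hβinv, hzαβ⟩ := hfrac z hz
  obtain ⟨σ, hσ, τ, hτ, hτinv, hsστ⟩ := hfrac s hs
  have hs0 : s ≠ 0 := by
    intro h0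
    apply hsq
    have : (⟨s, hs⟩ : A') = 0 := Subtype.ext h0
    rw [this]; exact Ideal.zero_mem _
  have hβ0 : β ≠ 0 := by
    intro h0; apply hz0; rw [hzαβ, h0, div_zero]
  have hτ0 : τ ≠ 0 := by
    intro h0; apply hs0; rw [hsστ, h0, div_zero]
  have hσ0 : σ ≠ 0 := by
    intro h0; apply hs0; rw [hsστ, h0, zero_div]
  obtain ⟨i, α₀, -, hαeq⟩ := QuadraticStep.exists_eq_div_pow_of_mem_blowupRing hxm hx0' hα
  obtain ⟨j, β₀, -, hβeq⟩ := QuadraticStep.exists_eq_div_pow_of_mem_blowupRing hxm hx0' hβ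
  obtain ⟨k, σ₀, -, hσeq⟩ := QuadraticStep.exists_eq_div_pow_of_mem_blowupRing hxm hx0' hσ
  obtain ⟨l, τ₀, -, hτeq⟩ := QuadraticStep.exists_eq_div_pow_of_mem_blowupRing hxm hx0' hτ
  have hβA' : β ∈ A' := hB hβ
  have hτA' : τ ∈ A' := hB hτ
  have hσA' : σ ∈ A' := hB hσ
  -- `β, τ ∉ 𝔮'` (units), `σ = s τ ∉ 𝔮'`
  have hβq : (⟨β, hβA'⟩ : A') ∉ 𝔮' := not_mem_prime_of_inv_mem hβA' hβinv hβ0 𝔮'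
  have hτq : (⟨τ, hτA'⟩ : A') ∉ 𝔮' := not_mem_prime_of_inv_mem hτA' hτinv hτ0 𝔮'
  have hσq : (⟨σ, hσA'⟩ : A') ∉ 𝔮' := by
    have hst : σ = s * τ := by rw [hsστ, div_mul_cancel₀ _ hτ0]
    have h' := hmul hs hτA' hsq hτq
    have : (⟨s * τ, A'.mul_mem hs hτA'⟩ : A') = ⟨σ, hσA'⟩ := Subtype.ext hst.symm
    rwa [this] at h'
  -- `β₀ = β x^j ∉ 𝔮'`, `σ₀ = σ x^k ∉ 𝔮'`
  have hβ₀eq : (β₀ : K) = β * (x : K) ^ j := by rw [hβeq, div_mul_cancel₀ _ (pow_ne_zero _ hx0')]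
  have hσ₀eq : (σ₀ : K) = σ * (x : K) ^ k := by rw [hσeq, div_mul_cancel₀ _ (pow_ne_zero _ hx0')]
  have hβ₀q : (⟨(β₀ : K), hle β₀.2⟩ : A') ∉ 𝔮' := by
    have h' := hmul hβA' (A'.pow_mem (hle x.2) j) hβq (hxpow j)
    have : (⟨β * (x : K) ^ j, A'.mul_mem hβA' (A'.pow_mem (hle x.2) j)⟩ : A') = ⟨(β₀ : K), hle β₀.2⟩ :=
      Subtype.ext hβ₀eq.symm
    rwa [this] at h'
  have hσ₀q : (⟨(σ₀ : K), hle σ₀.2⟩ : A') ∉ 𝔮' := by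
    have h' := hmul hσA' (A'.pow_mem (hle x.2) k) hσq (hxpow k)
    have : (⟨σ * (x : K) ^ k, A'.mul_mem hσA' (A'.pow_mem (hle x.2) k)⟩ : A') = ⟨(σ₀ : K), hle σ₀.2⟩ :=
      Subtype.ext hσ₀eq.symm
    rwa [this] at h'
  -- the witnesses
  refine ⟨(α₀ : K) * τ₀ * (x : K) ^ (j + k), (β₀ : K) * σ₀ * (x : K) ^ (i + l),
    A.mul_mem (A.mul_mem α₀.2 τ₀.2) (A.pow_mem x.2 _), A.mul_mem (A.mul_mem β₀.2 σ₀.2) (A.pow_mem x.2 _), ?_, ?_⟩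
  · -- `β₀ σ₀ x^{i+l} ∉ 𝔮'`
    have h1 := hmul (hle β₀.2) (hle σ₀.2) hβ₀q hσ₀q
    have h2 := hmul (A'.mul_mem (hle β₀.2) (hle σ₀.2)) (A'.pow_mem (hle x.2) (i + l)) h1 (hxpow (i + l))
    exact h2
  · -- the cross-multiplication identity in `κ`
    have hτ₀0 : (τ₀ : K) ≠ 0 := by
      intro h0; apply hτ0; rw [hτeq, h0, zero_div]
    have hβ₀0 : (β₀ : K) ≠ 0 := by
      intro h0; apply hβ0; rw [hβeq, h0, zero_div]
    rw [hzαβ, hsστ, hαeq, hβeq, hσeq, hτeq]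
    field_simp
    ring

/-! ## §3 The local rings agree: `(A')_{𝔮'}` is the localisation of `A` at `𝔮' ∩ A` -/

/-- **Off the exceptional prime the point step is a local isomorphism** (`IsLocalization` form): for a quadratic transform
`A ⊂ A'` of local subrings of `κ` and a prime `𝔮'` of `A'` with `𝔮 := 𝔮' ∩ A ≠ 𝔪_A`, the local ring `(A')_{𝔮'}` is the
localisation of `A` at `𝔮` along `A → A' → (A')_{𝔮'}`. Consequences for D3c (F5 (ii)): `(A')_{𝔮'} ≅ A_𝔮` canonically
(`IsLocalization.algEquiv`), so the radicand is singular along `𝔮'` iff along `𝔮` (with `exists_sub_sq_mem_iff_of_pointStep`, `x̄` being a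
unit there), both are discrete valuation rings together, and the residue fields agree — the curve germs `A/𝔮 ↪ A'/𝔮'` live in one
field. [cite: Cutkosky2014, §2.1] [cite: Kollar2007, §1.4] -/
theorem isLocalization_atPrime_of_quadraticTransform {A A' : Subring K} [IsLocalRing A] (h : IsQuadraticTransform A A')
    (𝔮' : Ideal A') [𝔮'.IsPrime] (hne : 𝔮'.comap (Subring.inclusion h.dominates.1) ≠ maximalIdeal A) :
    letI : Algebra A (Localization.AtPrime 𝔮') :=
      ((algebraMap A' (Localization.AtPrime 𝔮')).comp (Subring.inclusion h.dominates.1)).toAlgebra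
    IsLocalization.AtPrime (Localization.AtPrime 𝔮') (𝔮'.comap (Subring.inclusion h.dominates.1)) := by
  letI : Algebra A (Localization.AtPrime 𝔮') :=
    ((algebraMap A' (Localization.AtPrime 𝔮')).comp (Subring.inclusion h.dominates.1)).toAlgebra
  have hle : A ≤ A' := h.dominates.1
  have halg : ∀ a : A, algebraMap A (Localization.AtPrime 𝔮') a =
      algebraMap A' (Localization.AtPrime 𝔮') (Subring.inclusion hle a) := fun a => rfl
  have hinjA' : Function.Injective (algebraMap A' (Localization.AtPrime 𝔮')) :=
    IsLocalization.injective (Localization.AtPrime 𝔮') 𝔮'.primeCompl_le_nonZeroDivisors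
  refine ⟨?_, ?_, ?_⟩
  · rintro ⟨y, hy⟩
    rw [halg]
    exact IsLocalization.map_units (Localization.AtPrime 𝔮') (⟨Subring.inclusion hle y, hy⟩ : 𝔮'.primeCompl)
  · intro w
    obtain ⟨⟨z, s⟩, hw⟩ := IsLocalization.surj 𝔮'.primeCompl w
    obtain ⟨a, b, ha, hb, hbq, hzb⟩ :=
      exists_mul_eq_mul_of_quadraticTransform h 𝔮' hne z.2 s.1.2 (by obtain ⟨⟨s, hs⟩, hsq⟩ := s; exact hsq)
    refine ⟨⟨⟨a, ha⟩, ⟨⟨b, hb⟩, hbq⟩⟩, ?_⟩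
    change w * algebraMap A _ ⟨b, hb⟩ = algebraMap A _ ⟨a, ha⟩
    rw [halg, halg]
    have hzb' : z * (⟨b, hle hb⟩ : A') = (⟨a, hle ha⟩ : A') * (s : A') := Subtype.ext hzb
    have hu : IsUnit (algebraMap A' (Localization.AtPrime 𝔮') (s : A')) :=
      IsLocalization.map_units (Localization.AtPrime 𝔮') s
    -- `w φ(s) = φ(z)` ⇒ `w φ(s) φ(b) = φ(z) φ(b) = φ(a) φ(s)` ⇒ `w φ(b) = φ(a)`
    have key : w * algebraMap A' _ (⟨b, hle hb⟩ : A') * algebraMap A' _ (s : A') =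
        algebraMap A' _ (⟨a, hle ha⟩ : A') * algebraMap A' _ (s : A') := by
      rw [mul_assoc, mul_comm (algebraMap A' _ (⟨b, hle hb⟩ : A')), ← mul_assoc, hw, ← map_mul, ← map_mul, hzb']
    exact hu.mul_left_injective key
  · intro a₁ a₂ heq
    refine ⟨1, ?_⟩
    rw [halg, halg] at heq
    have := Subring.inclusion_injective hle (hinjA' heq)
    rw [this]

end Summit.ResolutionOfSingularities.ResolutionOfSingularities.Theorems.SwitchingDichotomy.BadCurveStep

end
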